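import Summits.QuantumAdvantage.AdviceFreeQNC0.AffBells35WRELFiring

/-!
# qa-qnc0-p1 g35 — `PolyLossOfWREL` and the wired-elimination line, part 3/7: `TypicalPerfectQuiet` from `DualSZDecoupling` (fibre identity over 𝔽₄ + dual Schwartz–Zippel bookkeeping)

Continuation of `AffBells35WRELFiring`.

Ported to the tree VERBATIM (split into seven files `AffBells35PolyLossOfWREL` / `AffBells35WREL{Firing,Quiet,Typical,Structure,Twins,Toggle}` for the 400-line rule; lint fixes only: `push Not`, `card_filter_add_card_filter_not`, unused simp arguments, two `_`-binders) by the prover seat qn-prover-3 g20 at the ask of planner qa-qnc0-p1 g36 (INBOX 11:15Z: exp35/WREL35.lean FROZEN, 1891 l., farm rc 0 / 0 sorry); authored and proved by the planner seat qa-qnc0-p1 g35.  Serves the crux stmt-QuantumAdvantage-22907 (route DWalkThree); untagged (the gate refuses `--supports` across sub-problems on AdviceFreeQNC0/ targets).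
-/

noncomputable section
open Classical

namespace Summit.QuantumAdvantage.AdviceFreeQNC0.AffBells35

open Finset Literature.Computability.QuantumComplexity Literature.Computability.QuantumComplexity.RingHLF
open AffBells23 Fib19 AffBells26 AffBells29

variable {N : ℕ}

/-! ### `TypicalPerfectQuiet` PROVED from `DualSZDecoupling` (P-38ad, exp35/DualSZ35.lean; landing p711703) — ROUND-34 §12.12(u).
The fibre of `x` is parametrised by the even coin flips `y` (`AffBells33.xOf`); the active bells are affine MOD₃ tests
`[⟨P_h, y⟩ = r_h]` (`testMat`, `testRhs`); over `𝔽₄` each test indicator is `1 + χ(−r_h)·Q_{P_h}(y) + χ(−2r_h)·Q_{2P_h}(y)`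
(`ite_eq_eq_chi`); perfectness + `rel_xOf_iff` make the holomorphic sum constant on the even parity coset; typicality gives the width and
separation hypotheses of `DualSZDecoupling` for `Q` = (active rows of `K`) × {both exponents}; its conclusion says the `K`-part of the
pass count has the parity of `#(K ∩ active)`, i.e. the quiet count is even. -/

section TPQ

open Literature.Computability.MetaComplexity Literature.Computability.MetaComplexity.HoloCoset
open Literature.Computability.MetaComplexity.CosetFourier Literature.Computability.MetaComplexity.ParityModTestDensity
open AffBells33 AffBells28 AffBells28lit

/-- **P-38ad `DualSZDecoupling`** as a `Prop` (verbatim exp35/Sketch35.lean; PROVED in exp35/DualSZ35.lean, rc 0, 0 sorry). -/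
def DualSZDecoupling : Prop :=
  ∀ (F : Type) [Field F] [CharP F 2] (ω : F), ω ^ 2 + ω + 1 = 0 →
    ∀ (z m D : ℕ) (a : Fin m → F) (w : Fin m → Fin z → ZMod 3) (ε : Bool) (Q : Finset (Fin m)) (κ : F),
      9 * (m + 1) ^ 2 * (z + 1) ^ 2 < 2 ^ D →
      (∀ g ∈ Q, D ≤ (CosetFourier.wsupp (w g)).card) →
      (∀ g ∈ Q, ∀ h, h ∉ Q → D ≤ CosetFourier.hdist (w g) (w h)) →
      (∀ u ∈ parityCoset z ε, holoSum ω a w u = κ) →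
        ∀ u ∈ parityCoset z ε, (∑ g ∈ Q, a g * cubeChar ω (w g) u) = 0

/-- `dScale_bound` (planner qa-qnc0-p1 g35, exp35/WREL35.lean; see the section header above). -/
theorem dScale_bound (N : ℕ) : 9 * (2 * N + 1) ^ 2 * (N + 1) ^ 2 < 2 ^ dScale N := by
  have hlt : N < 2 ^ (Nat.log 2 N + 1) := Nat.lt_pow_succ_log_self one_lt_two N
  set L := Nat.log 2 N
  have h1 : 2 * N + 1 ≤ 2 * 2 ^ (L + 1) := by omega
  have h2 : N + 1 ≤ 2 ^ (L + 1) := by omega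
  have hX : 0 < 2 ^ (4 * L + 4) := pow_pos (by norm_num) _
  calc 9 * (2 * N + 1) ^ 2 * (N + 1) ^ 2 ≤ 9 * (2 * 2 ^ (L + 1)) ^ 2 * (2 ^ (L + 1)) ^ 2 := by gcongr
    _ = 36 * 2 ^ (4 * L + 4) := by ring
    _ < 4096 * 2 ^ (4 * L + 4) := by linarith
    _ = 2 ^ dScale N := by unfold dScale; ring

/-- counting through the coin enumeration. -/
theorem card_filter_coinEmb (x : Fin N → Bool) (p : Fin N → Prop) [DecidablePred p] :
    (univ.filter fun t : Fin (coinsOf x).card => p (coinEmb x t)).card = ((coinsOf x).filter p).card := by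
  rw [← Finset.card_map ⟨coinEmb x, coinEmb_injective x⟩]
  congr 1
  ext i
  simp only [mem_map, mem_filter, mem_univ, true_and, Function.Embedding.coeFn_mk]
  constructor
  · rintro ⟨t, ht, rfl⟩
    exact ⟨coinEmb_mem x t, ht⟩
  · rintro ⟨hi, hp⟩
    obtain ⟨t, rfl⟩ := exists_coinEmb_eq x hi
    exact ⟨t, hp, rfl⟩

/-- `coinDist_eq` (planner qa-qnc0-p1 g35, exp35/WREL35.lean; see the section header above). -/
theorem coinDist_eq (β : Fin N → Fin N → ZMod 3) (x : Fin N → Bool) (v w : Fin N → ZMod 3) :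
    coinDist β x v w = ((coinsOf x).filter fun i => v i ≠ w i).card := by
  unfold coinDist coinsOf
  rw [filter_filter]

/-- the bell of an ACTIVE row on the fibre, in test coordinates. -/
theorem affBell_xOf_iff (β : Fin N → Fin N → ZMod 3) (c : Fin N → ZMod 3) (x : Fin N → Bool)
    (y : Fin (coinsOf x).card → Bool) (h : Fin N) (hact : kline x h = true) :
    affBell β c (xOf x y) h = true ↔ (∑ t, if y t then testMat β x h t else 0) = testRhs β c x h := by
  simp only [testMat, testRhs, hact, ↓reduceIte]
  rw [affBell_eq_true_iff, form_xOf, eq_sub_iff_add_eq, add_comm]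

/-- **FIBREWISE SILENCE (deterministic; the Fourier step in its natural generality, ROUND-34 §12.12(v)).**  On the fibre of an odd
`x` (`N ≥ 3`), let `K` be ANY set of rows such that every ACTIVE row of `K` has `≥ dScale N` coins in its support and is at coin
distance `≥ dScale N` (in both twists) from every ACTIVE row outside `K`.  If the fibre is perfect, the number of quiet `K`-bells is
EVEN at every input of the fibre — so firing `K` (to always-true) changes no outcome on this fibre.  No typicality, no components, no
near-perfectness: `DualSZDecoupling` with `Q` = the active `K`-terms. -/
theorem quiet_of_coinSeparated (hDSZ : DualSZDecoupling) {N : ℕ} (hN : 3 ≤ N)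
    (β : Fin N → Fin N → ZMod 3) (c : Fin N → ZMod 3) (K : Finset (Fin N)) (x : Fin N → Bool) (hodd : IsOdd x)
    (HW : ∀ h ∈ K, kline x h = true → dScale N ≤ coinDist β x (β h) (fun _ => 0))
    (HS : ∀ h h', h ∈ K → kline x h = true → h' ∉ K → kline x h' = true →
      dScale N ≤ coinDist β x (β h) (β h') ∧ dScale N ≤ coinDist β x (β h) (fun i => 2 * β h' i))
    (hperf : PerfectFibre β c (kline x)) :
    ∀ x', IsOdd x' → kline x' = kline x → quietCount β c K x' % 2 = 0 := by
  unfold DualSZDecoupling at hDSZ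
  intro x' hodd' hk
  obtain ⟨y, hy, rfl⟩ := exists_xOf_eq hN hodd hodd' hk
  haveI : Fact (Nat.Prime 2) := ⟨Nat.prime_two⟩
  obtain ⟨ω, hω⟩ := exists_omega_galoisField
  have h3 : ω ^ 3 = 1 := omega_pow_three hω
  have h2 : (2 : GaloisField 2 2) = 0 := CharTwo.two_eq_zero
  -- test coordinates on the fibre of `x`
  set P : Fin N → Fin (coinsOf x).card → ZMod 3 := testMat β x with hP
  set r : Fin N → ZMod 3 := testRhs β c x with hr
  -- the exponent family, indexed by (row, which exponent), then by `Fin m`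
  set m := Fintype.card (Fin N × Bool) with hmdef
  let e : (Fin N × Bool) ≃ Fin m := Fintype.equivFin (Fin N × Bool)
  let a' : Fin N × Bool → GaloisField 2 2 := fun p => if p.2 then AffBells33.chi ω (-(r p.1) + -(r p.1)) else AffBells33.chi ω (-(r p.1))
  let w' : Fin N × Bool → Fin (coinsOf x).card → ZMod 3 := fun p => if p.2 then (fun t => 2 * P p.1 t) else P p.1
  let aF : Fin m → GaloisField 2 2 := fun g => a' (e.symm g)
  let wF : Fin m → Fin (coinsOf x).card → ZMod 3 := fun g => w' (e.symm g)
  let Q : Finset (Fin m) := univ.filter fun g => (e.symm g).1 ∈ K ∧ kline x (e.symm g).1 = true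
  let κ : GaloisField 2 2 := (tauOf x : GaloisField 2 2) + (N : GaloisField 2 2)
  have hm : m = 2 * N := by rw [hmdef, Fintype.card_prod, Fintype.card_fin, Fintype.card_bool]; ring
  have hzN : (coinsOf x).card ≤ N := card_coinsOf_le x
  have hD : 9 * (m + 1) ^ 2 * ((coinsOf x).card + 1) ^ 2 < 2 ^ dScale N := by
    calc 9 * (m + 1) ^ 2 * ((coinsOf x).card + 1) ^ 2 ≤ 9 * (2 * N + 1) ^ 2 * (N + 1) ^ 2 := by rw [hm]; gcongr
      _ < 2 ^ dScale N := dScale_bound N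
  -- (1) the test indicator as `1 +` two characters
  have hexp : ∀ (h : Fin N) (u : Fin (coinsOf x).card → Bool),
      (if (∑ t, if u t then P h t else 0) = r h then (1 : GaloisField 2 2) else 0)
        = 1 + (a' (h, false) * cubeChar ω (w' (h, false)) u + a' (h, true) * cubeChar ω (w' (h, true)) u) := by
    intro h u
    rw [ite_eq_eq_chi hω]
    have hA : AffBells33.chi ω ((∑ t, if u t then P h t else 0) - r h) = AffBells33.chi ω (-(r h)) * cubeChar ω (P h) u := by
      rw [sub_eq_add_neg, chi_add h3, mul_comm]; rfl
    have hsum2 : (∑ t, if u t then 2 * P h t else (0 : ZMod 3)) = 2 * ∑ t, (if u t then P h t else 0) := by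
      rw [mul_sum]; exact sum_congr rfl fun t _ => by split_ifs <;> ring
    have h2A : AffBells33.chi ω ((∑ t, if u t then P h t else 0) - r h) ^ 2
        = AffBells33.chi ω (-(r h) + -(r h)) * cubeChar ω (fun t => 2 * P h t) u := by
      rw [sq, ← chi_add h3,
        show ((∑ t, if u t then P h t else 0) - r h) + ((∑ t, if u t then P h t else 0) - r h)
            = (∑ t, if u t then 2 * P h t else (0 : ZMod 3)) + (-(r h) + -(r h)) by rw [hsum2]; ring,
        chi_add h3, mul_comm]
      rfl
    rw [h2A, hA]
    simp only [a', w', Bool.false_eq_true, ↓reduceIte]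
    ring
  -- (2) the holomorphic sum, re-indexed by rows
  have hholo : ∀ u, holoSum ω aF wF u
      = ∑ h : Fin N, (a' (h, false) * cubeChar ω (w' (h, false)) u + a' (h, true) * cubeChar ω (w' (h, true)) u) := by
    intro u
    unfold holoSum
    rw [show (∑ g : Fin m, aF g * cubeChar ω (wF g) u) = ∑ p : Fin N × Bool, a' p * cubeChar ω (w' p) u from
      e.symm.sum_comp (fun p => a' p * cubeChar ω (w' p) u), Fintype.sum_prod_type]
    exact sum_congr rfl fun h _ => by rw [Fintype.sum_bool, add_comm]
  -- (3) perfectness ⇒ the holomorphic sum is constant on the even coset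
  have hconst : ∀ u ∈ parityCoset (coinsOf x).card false, holoSum ω aF wF u = κ := by
    intro u hu
    have hu' : AffBells33.onesCard u % 2 = 0 := by
      have := (mem_filter.1 hu).2
      rw [decide_eq_false_iff_not, Nat.odd_iff] at this
      unfold AffBells33.onesCard; omega
    have hrel := hperf (xOf x u) (isOdd_xOf hodd hu') (kline_xOf hN hodd hu')
    rw [rel_xOf_iff hN hodd hu'] at hrel
    unfold testCount at hrel
    -- pass count as a field element
    have hpass : ((univ.filter fun h : Fin N => (∑ t, if u t then P h t else 0) = r h).card : GaloisField 2 2)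
        = (N : GaloisField 2 2) + holoSum ω aF wF u := by
      rw [hholo u, ← Finset.sum_boole]
      rw [sum_congr rfl fun h _ => hexp h u, sum_add_distrib]
      simp
    have hpt : (univ.filter fun h : Fin N => (∑ t, if u t then P h t else 0) = r h).card % 2 = tauOf x % 2 := by
      simp only [hP, hr] at hrel ⊢; omega
    have hcast : ((univ.filter fun h : Fin N => (∑ t, if u t then P h t else 0) = r h).card : GaloisField 2 2)
        = (tauOf x : GaloisField 2 2) := by
      rw [natCast_eq_ite, natCast_eq_ite (tauOf x), hpt]
    rw [hcast] at hpass
    have hNN : (N : GaloisField 2 2) + (N : GaloisField 2 2) = 0 := CharTwo.add_self_eq_zero _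
    calc holoSum ω aF wF u = ((N : GaloisField 2 2) + holoSum ω aF wF u) + N := by
          rw [add_comm (N : GaloisField 2 2), add_assoc, hNN, add_zero]
      _ = κ := by rw [← hpass]
  -- (4) widths and separations from typicality
  have hwsupp : ∀ h, kline x h = true → ∀ s, (CosetFourier.wsupp (w' (h, s))).card = coinDist β x (β h) (fun _ => 0) := by
    intro h hact s
    have hset : CosetFourier.wsupp (w' (h, s)) = univ.filter fun t => β h (coinEmb x t) ≠ 0 := by
      ext t
      simp only [CosetFourier.wsupp, mem_filter, mem_univ, true_and, w', hP, testMat, hact, ↓reduceIte, sdelta]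
      cases s <;> simp [testMat, sdelta, hact, Z3.sd_ne_zero, Z3.two_ne_zero]
    rw [hset, coinDist_eq]
    convert card_filter_coinEmb x (fun i => β h i ≠ 0) using 3
  have hsepKey : ∀ h h' : Fin N, h ∈ K → kline x h = true → ¬ (h' ∈ K ∧ kline x h' = true) →
      ∀ s s', dScale N ≤ CosetFourier.hdist (w' (h, s)) (w' (h', s')) := by
    intro h h' hK hact hnot s s'
    by_cases hact' : kline x h' = true
    · have hK' : h' ∉ K := fun hh => hnot ⟨hh, hact'⟩
      obtain ⟨hd1, hd2⟩ := HS h h' hK hact hK' hact'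
      have hset : (univ.filter fun t => w' (h, s) t ≠ w' (h', s') t)
          = univ.filter fun t => if s = s' then β h (coinEmb x t) ≠ β h' (coinEmb x t)
              else β h (coinEmb x t) ≠ 2 * β h' (coinEmb x t) := by
        ext t
        simp only [mem_filter, mem_univ, true_and, w', hP, testMat, hact, hact', ↓reduceIte, sdelta]
        cases s <;> cases s' <;> simp [testMat, sdelta, hact, hact', Z3.sd_ne_sd, Z3.two_ne_zero, Z3.two_mul_eq_iff]
      unfold CosetFourier.hdist
      rw [hset]
      by_cases hss : s = s'
      · simp only [hss, ↓reduceIte]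
        rw [coinDist_eq] at hd1
        convert hd1 using 1
        convert card_filter_coinEmb x (fun i => β h i ≠ β h' i) using 3
      · simp only [hss, ↓reduceIte]
        rw [coinDist_eq] at hd2
        convert hd2 using 1
        convert card_filter_coinEmb x (fun i => β h i ≠ 2 * β h' i) using 3
    · have hact'' : kline x h' = false := by simpa using hact'
      have hzero : ∀ t, w' (h', s') t = 0 := by
        intro t
        simp only [w', hP, testMat, hact'', Bool.false_eq_true, ↓reduceIte]
        cases s' <;> simp [testMat, hact'']
      have heq : CosetFourier.hdist (w' (h, s)) (w' (h', s')) = (CosetFourier.wsupp (w' (h, s))).card := by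
        unfold CosetFourier.hdist CosetFourier.wsupp
        congr 1
        ext t
        simp only [mem_filter, mem_univ, true_and, hzero t]
      rw [heq, hwsupp h hact s]
      exact HW h hK hact
  -- (5) apply the dual Schwartz–Zippel decoupling
  have hyC : y ∈ parityCoset (coinsOf x).card false := by
    refine mem_filter.2 ⟨mem_univ _, ?_⟩
    rw [decide_eq_false_iff_not, Nat.odd_iff]
    unfold AffBells33.onesCard at hy; omega
  have hvan := hDSZ (GaloisField 2 2) ω hω (coinsOf x).card m (dScale N) aF wF false Q κ hD
    (fun g hg => by
      obtain ⟨hK, hact⟩ := (mem_filter.1 hg).2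
      show dScale N ≤ (CosetFourier.wsupp (w' ((e.symm g).1, (e.symm g).2))).card
      rw [hwsupp _ hact]
      exact HW _ hK hact)
    (fun g hg g' hg' => by
      obtain ⟨hK, hact⟩ := (mem_filter.1 hg).2
      have hnot : ¬ ((e.symm g').1 ∈ K ∧ kline x (e.symm g').1 = true) :=
        fun hh => hg' (mem_filter.2 ⟨mem_univ _, hh⟩)
      show dScale N ≤ CosetFourier.hdist (w' ((e.symm g).1, (e.symm g).2)) (w' ((e.symm g').1, (e.symm g').2))
      exact hsepKey _ _ hK hact hnot _ _)
    hconst y hyC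
  -- (6) read the vanishing back on the rows of `K`
  set S : Finset (Fin N) := univ.filter fun h => h ∈ K ∧ kline x h = true with hSdef
  have hreidx : (∑ g ∈ Q, aF g * cubeChar ω (wF g) y)
      = ∑ h ∈ S, ((if (∑ t, if y t then P h t else 0) = r h then (1 : GaloisField 2 2) else 0) + 1) := by
    rw [sum_filter,
      show (∑ g : Fin m, if (e.symm g).1 ∈ K ∧ kline x (e.symm g).1 = true then aF g * cubeChar ω (wF g) y else 0)
          = ∑ p : Fin N × Bool, if p.1 ∈ K ∧ kline x p.1 = true then a' p * cubeChar ω (w' p) y else 0 from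
        e.symm.sum_comp (fun p : Fin N × Bool => if p.1 ∈ K ∧ kline x p.1 = true then a' p * cubeChar ω (w' p) y else 0),
      Fintype.sum_prod_type, sum_filter]
    refine sum_congr rfl fun h _ => ?_
    rw [Fintype.sum_bool]
    by_cases hh : h ∈ K ∧ kline x h = true
    · simp only [hh, and_self, ↓reduceIte]
      have hx := hexp h y
      linear_combination -hx - h2
    · simp only [hh, ↓reduceIte, add_zero]
  rw [hreidx, sum_add_distrib, Finset.sum_boole, sum_const, nsmul_eq_mul, mul_one] at hvan
  -- parity of (passes in S) + |S|
  have hpar : ((S.filter fun h => (∑ t, if y t then P h t else 0) = r h).card + S.card) % 2 = 0 := by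
    by_contra hodd1
    have h1 : ((S.filter fun h => (∑ t, if y t then P h t else 0) = r h).card + S.card) % 2 = 1 := by omega
    have := natCast_eq_ite (F := GaloisField 2 2)
      ((S.filter fun h => (∑ t, if y t then P h t else 0) = r h).card + S.card)
    rw [h1, if_pos rfl, Nat.cast_add, hvan] at this
    exact one_ne_zero this.symm
  -- the quiet count is |S| − passes
  have hpassS : (S.filter fun h => (∑ t, if y t then P h t else 0) = r h)
      = S.filter fun h => affBell β c (xOf x y) h = true := by
    refine filter_congr fun h hh => ?_
    rw [affBell_xOf_iff β c x y h ((mem_filter.1 hh).2.2)]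
  have hquiet : quietCount β c K (xOf x y) = (S.filter fun h => ¬ affBell β c (xOf x y) h = true).card := by
    unfold quietCount
    congr 1
    ext h
    simp only [mem_filter, mem_univ, true_and, hSdef, hk, Bool.not_eq_true, and_assoc]
  have hsplit := card_filter_add_card_filter_not (s := S) (fun h => affBell β c (xOf x y) h = true)
  rw [hpassS] at hpar
  rw [hquiet]
  omega

/-- **P-38an from P-38ad**: `DualSZDecoupling → TypicalPerfectQuiet` (position components of light-free typical fibres are
coin-separated and coin-wide, so `quiet_of_coinSeparated` applies). -/
theorem tpq_of_dualSZ (hDSZ : DualSZDecoupling) : TypicalPerfectQuiet := by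
  refine ⟨3, fun N hN R W β c b x hodd htyp hlf hperf x' hodd' hk => ?_⟩
  refine quiet_of_coinSeparated hDSZ hN β c (posComponent R β b) x hodd
    (fun h hK _ => htyp.2 h (hlf h hK)) (fun h h' hK _ hK' _ => ?_) hperf x' hodd' hk
  have hnn : ¬ NearRows R β h h' := by
    intro hnr
    apply hK'
    have hh := (mem_filter.1 hK).2
    exact mem_filter.2 ⟨mem_univ _, hh.tail hnr⟩
  exact htyp.1 h h' hnn

/-- **THE FORMAL LINE, final closing form of g35:** `DualSZDecoupling → TypicalMass → WiredElimination → AffBellsPolyLoss3`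
(`DualSZDecoupling` is PROVED in exp35/DualSZ35.lean; so (NP₁) ⟸ TypicalMass ∧ WiredElimination). -/
theorem polyLoss_of_dualSZ (h₀ : DualSZDecoupling) (h₁ : TypicalMass) (h₃ : WiredElimination) : AffBellsPolyLoss3 :=
  polyLoss_of_three h₁ (tpq_of_dualSZ h₀) h₃

end TPQ



end Summit.QuantumAdvantage.AdviceFreeQNC0.AffBells35
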